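import Mathlib.GroupTheory.SpecificGroups.Cyclic
import Mathlib.Tactic.Linarith
import HarnessLib

/-!
# A near-tiling by two translates forces a cyclic group

ω-census, family (b3).  Framing: lottery ticket; floor = certified bounds/negative ranges.

**Lemma (`zmultiples_eq_top_of_near_tiling`).** Let `A` be a finite abelian group, `d ∈ A`, and `P, C ⊆ A` with
`A = P ⊔ (P + d) ⊔ C`, `C ∩ (C + d) = ∅` and `|P| = |C| + 1`.  Then `d` generates `A`.
(Proof: `c ↦ c + d` maps `C` injectively into `P`, missing exactly one point `p*`; inside a coset `K` of `⟨d⟩` not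
containing `p*` this map is onto `P ∩ K`, so `|K| = 3|P ∩ K|`, while `|K*| = 3|P ∩ K*| − 1` for the coset of `p*`;
all cosets have the same size, so there is only one.)  This is the combinatorial core of "the generalized dihedral
law `4⌊2|A|/3⌋` is attained only when `A` is cyclic" (`DihedralLawAttainedCyclic.lean`): an extremal TPP triple of
`Dih(A)` with `|A| ≡ 2 (mod 3)` is forced into the shape `S = {ρs, τs'}`, `T = {ρt, τt'}`, and then the two sumset
triangles are exactly such a near-tiling with `d = (s' + t) − (s + t')`
(the cyclic rotation lemma `TripleProductProperty.rotate` is in `Literature/Combinatorics/Additive/TPPGroupAlgebra.lean`).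
-/

namespace Summit.MatrixMultiplication.OmegaCensus

open Finset


section NearTiling

variable {A : Type*} [AddCommGroup A] [Fintype A] [DecidableEq A]

/-- **A near-tiling by two `d`-translates and a `d`-free set forces `⟨d⟩ = A`.** [folklore] -/
theorem zmultiples_eq_top_of_near_tiling {P C : Finset A} {d : A}
    (hPC : Disjoint P C) (hPdC : Disjoint (P.image fun x => x + d) C)
    (hcov : P ∪ P.image (fun x => x + d) ∪ C = univ)
    (hCC : Disjoint C (C.image fun x => x + d)) (hcard : P.card = C.card + 1)
    (hPP : Disjoint P (P.image fun x => x + d)) :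
    ∀ x : A, x ∈ AddSubgroup.zmultiples d := by
  classical
  set D := AddSubgroup.zmultiples d with hDdef
  have hdD : d ∈ D := AddSubgroup.mem_zmultiples d
  -- where the elements go under `+ d`
  have memA : ∀ x : A, x ∈ P ∨ x ∈ P.image (fun x => x + d) ∨ x ∈ C := by
    intro x
    have hx : x ∈ P ∪ P.image (fun x => x + d) ∪ C := by rw [hcov]; exact mem_univ x
    simpa [mem_union, or_assoc] using hx
  have hCP : ∀ c ∈ C, c + d ∈ P := by
    intro c hc
    rcases memA (c + d) with h | h | h
    · exact h
    · obtain ⟨p, hp, hpe⟩ := mem_image.1 h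
      have : p = c := add_right_cancel hpe
      subst this
      exact absurd hc (disjoint_left.1 hPC hp)
    · exact absurd (mem_image_of_mem (fun x => x + d) hc) (disjoint_left.1 hCC h)
  -- the image `C + d ⊆ P` misses exactly one point `p⋆`
  have himg : C.image (fun x => x + d) ⊆ P := image_subset_iff.2 hCP
  have hcimg : (C.image fun x => x + d).card = C.card := card_image_of_injective _ (add_left_injective d)
  obtain ⟨ps, hps⟩ : ∃ p, P \ C.image (fun x => x + d) = {p} :=
    card_eq_one.1 (by rw [card_sdiff_of_subset himg, hcimg, hcard]; omega)
  have hpsP : ps ∈ P ∧ ps ∉ C.image (fun x => x + d) := by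
    have h := mem_singleton_self ps
    rw [← hps, mem_sdiff] at h
    exact h
  have hPre : ∀ p ∈ P, p ≠ ps → ∃ c ∈ C, c + d = p := by
    intro p hp hne
    by_contra hnot
    have hm : p ∈ P \ C.image (fun x => x + d) := mem_sdiff.2 ⟨hp, fun h => hnot (by simpa using mem_image.1 h)⟩
    rw [hps, mem_singleton] at hm
    exact hne hm
  -- cosets of `D` as finsets: `K x = {y | y - x ∈ D}`; all have the size of `D`
  have Kcard : ∀ x : A, (univ.filter fun y => y - x ∈ D).card = (univ.filter fun y => y ∈ D).card := by
    intro x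
    have hK : (univ.filter fun y => y ∈ D).image (fun y => y + x) = univ.filter fun y => y - x ∈ D := by
      ext y
      simp only [mem_image, mem_filter, mem_univ, true_and]
      constructor
      · rintro ⟨z, hz, rfl⟩; simpa using hz
      · intro hy; exact ⟨y - x, hy, sub_add_cancel y x⟩
    rw [← hK, card_image_of_injective _ (add_left_injective x)]
  have shiftD : ∀ x y : A, y - x ∈ D → y + d - x ∈ D := fun x y h => by
    have := D.add_mem h hdD; rwa [sub_add_eq_add_sub] at this
  have shiftD' : ∀ x y : A, y - x ∈ D → y - d - x ∈ D := fun x y h => by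
    have := D.sub_mem h hdD; rwa [sub_right_comm] at this
  -- decomposition of a coset along `P`, `P + d`, `C`
  have Kdecomp : ∀ x : A, (univ.filter fun y => y - x ∈ D).card =
      (P.filter fun y => y - x ∈ D).card + ((P.image fun x => x + d).filter fun y => y - x ∈ D).card +
        (C.filter fun y => y - x ∈ D).card := by
    intro x
    rw [← hcov, filter_union, filter_union,
      card_union_of_disjoint (disjoint_union_left.2 ⟨disjoint_filter_filter hPC, disjoint_filter_filter hPdC⟩),
      card_union_of_disjoint (disjoint_filter_filter hPP)]
  have KPd : ∀ x : A, ((P.image fun x => x + d).filter fun y => y - x ∈ D).card =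
      (P.filter fun y => y - x ∈ D).card := by
    intro x
    have hEq : (P.filter fun y => y - x ∈ D).image (fun y => y + d) =
        (P.image fun x => x + d).filter fun y => y - x ∈ D := by
      ext y
      simp only [mem_image, mem_filter]
      constructor
      · rintro ⟨p, ⟨hp, hpD⟩, rfl⟩; exact ⟨⟨p, hp, rfl⟩, shiftD x p hpD⟩
      · rintro ⟨⟨p, hp, rfl⟩, hD⟩
        exact ⟨p, ⟨hp, by have := shiftD' x (p + d) hD; rwa [add_sub_cancel_right] at this⟩, rfl⟩
    rw [← hEq, card_image_of_injective _ (add_left_injective d)]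
  -- a coset not containing `p⋆`: `|C ∩ K| = |P ∩ K|`
  have KC : ∀ x : A, ps - x ∉ D →
      (C.filter fun y => y - x ∈ D).card = (P.filter fun y => y - x ∈ D).card := by
    intro x hx
    have hEq : (C.filter fun y => y - x ∈ D).image (fun y => y + d) = P.filter fun y => y - x ∈ D := by
      ext y
      simp only [mem_image, mem_filter]
      constructor
      · rintro ⟨c, ⟨hc, hcD⟩, rfl⟩; exact ⟨hCP c hc, shiftD x c hcD⟩
      · rintro ⟨hy, hyD⟩
        have hne : y ≠ ps := fun h => hx (h ▸ hyD)
        obtain ⟨c, hc, rfl⟩ := hPre y hy hne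
        exact ⟨c, ⟨hc, by have := shiftD' x (c + d) hyD; rwa [add_sub_cancel_right] at this⟩, rfl⟩
    rw [← hEq, card_image_of_injective _ (add_left_injective d)]
  -- the coset of `p⋆`: `|C ∩ K⋆| + 1 = |P ∩ K⋆|`
  have KCs : (C.filter fun y => y - ps ∈ D).card + 1 = (P.filter fun y => y - ps ∈ D).card := by
    have hEq : (C.filter fun y => y - ps ∈ D).image (fun y => y + d) =
        (P.filter fun y => y - ps ∈ D).erase ps := by
      ext y
      simp only [mem_image, mem_filter, mem_erase]
      constructor
      · rintro ⟨c, ⟨hc, hcD⟩, rfl⟩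
        exact ⟨fun h => hpsP.2 (mem_image.2 ⟨c, hc, h⟩), hCP c hc, shiftD ps c hcD⟩
      · rintro ⟨hne, hy, hyD⟩
        obtain ⟨c, hc, rfl⟩ := hPre y hy hne
        exact ⟨c, ⟨hc, by have := shiftD' ps (c + d) hyD; rwa [add_sub_cancel_right] at this⟩, rfl⟩
    have hmem : ps ∈ P.filter fun y => y - ps ∈ D := mem_filter.2 ⟨hpsP.1, by rw [sub_self]; exact D.zero_mem⟩
    rw [← card_erase_add_one hmem, ← hEq, card_image_of_injective _ (add_left_injective d)]
  -- every coset is the coset of `p⋆`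
  have hall : ∀ x : A, ps - x ∈ D := by
    intro x
    by_contra hx
    have h1 := Kdecomp x
    have h2 := Kdecomp ps
    rw [KPd x, KC x hx, Kcard x] at h1
    rw [KPd ps, Kcard ps] at h2
    omega
  intro x
  have h := hall (ps - x)
  rwa [sub_sub_cancel] at h

end NearTiling

end Summit.MatrixMultiplication.OmegaCensus
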